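import Summits.CriticalPhenomena.PercolationContinuityZ3.Theorems.PercAnnulusCrossingNoiseBonami
import Summits.CriticalPhenomena.PercolationContinuityZ3.Theorems.PercAnnulusCrossingNoiseStable
import HarnessLib

/-!
# RSW3 lane (lead, gen 22): HYPERCONTRACTIVITY OF THE NOISE OPERATOR, III — the `(4/3, 2)` bound for bounded functions,
# the level-`k` inequality, and the small-set expansion of the noisy cube

builds on p205010 (kernel theorem, internal audit signed; external expert review pending) — NOT used in this file (abstract).

Cell `prim-rsw3` (LANE 3), lead seat, gen 22.  Support file (`--supports stmt-CriticalPhenomena-4575`); no definitions, no named facts,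
no sorries.  Setting of parts I–II and gens 20–21: biases `p ∈ [0,1]^ι`, a character system `r` with (H1), (H2) (the p-biased one inside
the character-free statements), coefficients `f̂(S) = E_p[f·χ_S]`, the noise operator `T_ε` and its spectral formula
`E[f(ω)f(ω^ε)] = Σ_S (1−ε)^{|S|} f̂(S)²` (`noise_correlation_eq_sum_coeff_sq`), and the Bonami–Beckner inequality
`E[(T_ε f)⁴] ≤ (E f²)²` (`noise_fourth_moment_le_sq`, under `(1−ε)² ≤ 1/4`, `3(1−ε)⁴ ≤ p_i(1−p_i)`).  Write `ρ = 1 − ε`.  Proved here: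

* `sum_wt_mul_noise_noise_eq` — `E[f · T_ε(T_ε f)] = Σ_S ρ^{2|S|} f̂(S)²`, `sum_wt_noise_sq_eq` — `E[(T_ε f)²] = Σ_S ρ^{2|S|} f̂(S)²`
  (Plancherel + the diagonal noise operator twice);
* **`sq_noise_weight_le_cube`** — THE `(4/3, 2)` HYPERCONTRACTIVE BOUND FOR BOUNDED FUNCTIONS: if `|f| ≤ 1` then

      **`(Σ_S ρ^{2|S|} f̂(S)²)² ≤ (E_p|f|)³`**,  i.e. `‖T_ρ f‖₂ ≤ ‖f‖_{4/3}` for `f` with values in `[−1,1]`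

  (duality: `‖T_ρ f‖₂² = E[f·T_ρ² f] ≤ ‖f‖_{4/3}‖T_ρ(T_ρ f)‖₄ ≤ ‖f‖_{4/3}‖T_ρ f‖₂`, with Cauchy–Schwarz twice in place of Hölder);
* **`sq_low_weight_le_cube`**, `low_weight_le_inv_mul` — THE LEVEL-`k` INEQUALITY: **`(ρ^{2k}·Σ_{|S| ≤ k} f̂(S)²)² ≤ (E_p|f|)³`** — a function of small `L¹`-norm
  `α` has at most `ρ^{−2k}α^{3/2} ≪ α` of its spectral mass `Σ_S f̂(S)² ≤ α` below level `k ≤ c·log(1/α)`: SMALL SETS ARE HIGH-FREQUENCY;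
* **`noise_correlation_le_low_add_tail`**, **`noise_correlation_le_of_abs_le_one`** — THE SMALL-SET EXPANSION OF THE NOISY CUBE: for every
  second noise level `0 ≤ ε' ≤ 1` and every `k`,

      **`E_p[f(ω)f(ω^{ε'})] ≤ ρ^{−2k}·α·√α + (1−ε')^{k+1}·α`**,  `α = E_p|f|`;

  for the indicator of an event `A` of probability `α`: `P(ω ∈ A, ω^{ε'} ∈ A) ≤ α·(ρ^{−2k}√α + (1−ε')^{k+1})` — two `ε'`-correlated
  configurations share a RARE event with conditional probability at most `inf_k (ρ^{−2k}√α + (1−ε')^{k+1}) → 0` as `α → 0`, at a polynomial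
  rate in `α` (take `k ≍ log(1/α)`), for every fixed `ε' > 0` and every `p ∈ [0,1]^ι` with `min_i p_i(1−p_i) > 0` on the nondegenerate
  coordinates (the constraint on `ρ`).

Part IV (`…NoiseSmallSetsCritical`) applies this to the one-arm event at `p_c(ℤ^d)` and to long connections.

References: R. O'Donnell, *Analysis of Boolean Functions*, CUP 2014, §9.5 (level-k inequalities, Thm 9.22/9.24: small sets have most
Fourier weight at high levels; (4/3,2) by duality, Thm 9.21 ⇒ Cor 9.25), §10.1 (p-biased); C. Garban, J. Steif, *Noise sensitivity of Boolean
functions and percolation*, CUP 2014, Ch. V §5.3 (hypercontractivity ⇒ small sets are noise sensitive); I. Benjamini, G. Kalai, O. Schramm,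
Publ. Math. IHÉS 90 (1999) §1–3 (noise sensitivity via Bonami–Beckner); J. Kahn, G. Kalai, N. Linial, FOCS 1988 (the (4/3,2) use of Bonami's lemma).
-/

noncomputable section

namespace Summit.CriticalPhenomena.PercolationContinuityZ3.Theorems.Crossing.Spectral

open Finset Function
open Literature.Probability.ODonnellSaksSchrammServedio2005

variable {ι : Type*} [Fintype ι] [DecidableEq ι]

/-! ## §1 `E[f·T_ε(T_ε f)] = E[(T_ε f)²] = Σ_S ρ^{2|S|} f̂(S)²` -/

section Levels

variable {p : ι → ℝ} (h0 : ∀ i, 0 ≤ p i) (h1 : ∀ i, p i ≤ 1) {r : ι → Bool → ℝ}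
  (hH1 : ∀ i, p i * r i true + (1 - p i) * r i false = 0)
  (hH2 : ∀ i (b b' : Bool), coordWt p i b ≠ 0 → coordWt p i b' * (1 + r i b * r i b') = if b' = b then 1 else 0)

include hH1 hH2 in
/-- **`E[f · T_ε(T_ε f)] = Σ_S (1−ε)^{2|S|}·f̂(S)²`**: Plancherel and the diagonal noise operator applied twice.
[cite: ODonnell2014, §2.4 Prop 2.47 and §8.4 (T_ρ is diagonal in the p-biased basis; ⟨f, T_ρ T_ρ f⟩ = Σ_S ρ^{2|S|} f̂(S)²)] -/
theorem sum_wt_mul_noise_noise_eq (f : (ι → Bool) → ℝ) (ε : ℝ) :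
    ∑ x : ι → Bool, wt p x * (f x * (∑ y : ι → Bool, ∑ m : ι → Bool, wt p y * wt (fun _ => ε) m
        * (∑ y' : ι → Bool, ∑ m' : ι → Bool, wt p y' * wt (fun _ => ε) m'
            * f (fun i => if m' i = true then y' i else (if m i = true then y i else x i)))))
      = ∑ S ∈ (Finset.univ : Finset ι).powerset,
          ((1 - ε) ^ 2) ^ S.card * (∑ x : ι → Bool, wt p x * (f x * ∏ i ∈ S, r i (x i))) ^ 2 := by
  set F : (ι → Bool) → ℝ := fun z => ∑ y' : ι → Bool, ∑ m' : ι → Bool, wt p y' * wt (fun _ => ε) m'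
    * f (fun i => if m' i = true then y' i else z i) with hF
  rw [sum_wt_mul_mul_eq_sum_coeff hH2 f (fun x => ∑ y : ι → Bool, ∑ m : ι → Bool, wt p y * wt (fun _ => ε) m
        * F (fun i => if m i = true then y i else x i))]
  refine Finset.sum_congr rfl fun S _ => ?_
  rw [noise_coeff hH1 F ε S]
  simp only [hF]
  rw [noise_coeff hH1 f ε S, pow_right_comm (1 - ε) 2 S.card]
  ring

include hH1 hH2 in
/-- **`E[(T_ε f)²] = Σ_S (1−ε)^{2|S|}·f̂(S)²`** (Parseval for `T_ε f`).
[cite: ODonnell2014, §2.4 Prop 2.47 / §8.4 (‖T_ρ f‖₂² = Σ_S ρ^{2|S|} f̂(S)²)] -/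
theorem sum_wt_noise_sq_eq (f : (ι → Bool) → ℝ) (ε : ℝ) :
    ∑ x : ι → Bool, wt p x * (∑ y : ι → Bool, ∑ m : ι → Bool, wt p y * wt (fun _ => ε) m
        * f (fun i => if m i = true then y i else x i)) ^ 2
      = ∑ S ∈ (Finset.univ : Finset ι).powerset,
          ((1 - ε) ^ 2) ^ S.card * (∑ x : ι → Bool, wt p x * (f x * ∏ i ∈ S, r i (x i))) ^ 2 := by
  have h := sum_wt_mul_sq_eq_sum_coeff_sq hH2 (fun x : ι → Bool => ∑ y : ι → Bool, ∑ m : ι → Bool,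
    wt p y * wt (fun _ => ε) m * f (fun i => if m i = true then y i else x i))
  simp only [← sq] at h
  rw [h]
  refine Finset.sum_congr rfl fun S _ => ?_
  rw [noise_coeff hH1 f ε S, mul_pow, pow_right_comm]

/-! ## §2 The `(4/3, 2)` bound for bounded functions -/

include h0 h1 hH1 hH2 in
/-- **THE `(4/3, 2)` HYPERCONTRACTIVE BOUND FOR BOUNDED FUNCTIONS**: if `|f| ≤ 1`, `(1−ε)² ≤ 1/4` and `3(1−ε)⁴ ≤ p_i(1−p_i)` at every
nondegenerate coordinate, then `(Σ_S (1−ε)^{2|S|} f̂(S)²)² ≤ (E_p|f|)³` — i.e. `‖T_ρ f‖₂ ≤ ‖f‖_{4/3}` for functions with values in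
`[−1, 1]` (where `‖f‖_{4/3}^{4/3} ≤ E|f|`).  Duality with part II: `S₂ = E[f·T_ε T_ε f]`, `(E[f G])⁴ ≤ (E|f|)³·E[G⁴]` by Cauchy–Schwarz
twice, and `E[(T_ε(T_ε f))⁴] ≤ (E[(T_ε f)²])² = S₂²`.
[cite: ODonnell2014, §9.5 Cor 9.25 / Thm 9.22 ((4/3,2)-hypercontractivity from (2,4) by duality) and §10.1] [cite: Bonami1970, Ch. III Lemme 3] -/
theorem sq_noise_weight_le_cube {ε : ℝ} (hρ2 : (1 - ε) ^ 2 ≤ 1 / 4)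
    (hρ4 : ∀ i, 0 < p i → p i < 1 → 3 * (1 - ε) ^ 4 ≤ p i * (1 - p i))
    (f : (ι → Bool) → ℝ) (hf : ∀ x, |f x| ≤ 1) :
    (∑ S ∈ (Finset.univ : Finset ι).powerset,
        ((1 - ε) ^ 2) ^ S.card * (∑ x : ι → Bool, wt p x * (f x * ∏ i ∈ S, r i (x i))) ^ 2) ^ 2
      ≤ (∑ x : ι → Bool, wt p x * |f x|) ^ 3 := by
  -- `F = T_ε f`, `G = T_ε F`
  set F : (ι → Bool) → ℝ := fun z => ∑ y' : ι → Bool, ∑ m' : ι → Bool, wt p y' * wt (fun _ => ε) m'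
    * f (fun i => if m' i = true then y' i else z i) with hF
  set G : (ι → Bool) → ℝ := fun x => ∑ y : ι → Bool, ∑ m : ι → Bool, wt p y * wt (fun _ => ε) m
    * F (fun i => if m i = true then y i else x i) with hG
  set S2 : ℝ := ∑ S ∈ (Finset.univ : Finset ι).powerset,
        ((1 - ε) ^ 2) ^ S.card * (∑ x : ι → Bool, wt p x * (f x * ∏ i ∈ S, r i (x i))) ^ 2 with hS2
  set α : ℝ := ∑ x : ι → Bool, wt p x * |f x| with hα
  have hwt0 : ∀ x : ι → Bool, 0 ≤ wt p x := fun x => wt_nonneg h0 h1 x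
  have hfG : ∑ x : ι → Bool, wt p x * (f x * G x) = S2 := by
    rw [hS2, hG, hF]; exact sum_wt_mul_noise_noise_eq hH1 hH2 f ε
  have hF2 : ∑ x : ι → Bool, wt p x * F x ^ 2 = S2 := by
    rw [hS2, hF]; exact sum_wt_noise_sq_eq hH1 hH2 f ε
  have hBon : ∑ x : ι → Bool, wt p x * G x ^ 4 ≤ S2 ^ 2 := by
    rw [← hF2, hG]; exact noise_fourth_moment_le_sq p h0 h1 hρ2 hρ4 F
  -- Cauchy–Schwarz twice
  have hCS1 : (∑ x : ι → Bool, wt p x * (f x * G x)) ^ 2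
      ≤ (∑ x : ι → Bool, wt p x * |f x|) * ∑ x : ι → Bool, wt p x * (|f x| * G x ^ 2) :=
    Finset.sum_sq_le_sum_mul_sum_of_sq_le_mul _ (fun x _ => mul_nonneg (hwt0 x) (abs_nonneg _))
      (fun x _ => mul_nonneg (hwt0 x) (mul_nonneg (abs_nonneg _) (sq_nonneg _)))
      (fun x _ => le_of_eq (by
        rw [show wt p x * |f x| * (wt p x * (|f x| * G x ^ 2)) = (|f x| * |f x|) * (wt p x ^ 2 * G x ^ 2) by ring,
          abs_mul_abs_self]
        ring))
  have hCS2 : (∑ x : ι → Bool, wt p x * (|f x| * G x ^ 2)) ^ 2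
      ≤ (∑ x : ι → Bool, wt p x * |f x|) * ∑ x : ι → Bool, wt p x * (|f x| * G x ^ 4) :=
    Finset.sum_sq_le_sum_mul_sum_of_sq_le_mul _ (fun x _ => mul_nonneg (hwt0 x) (abs_nonneg _))
      (fun x _ => mul_nonneg (hwt0 x) (mul_nonneg (abs_nonneg _) (by positivity)))
      (fun x _ => le_of_eq (by ring))
  have hfG4 : ∑ x : ι → Bool, wt p x * (|f x| * G x ^ 4) ≤ ∑ x : ι → Bool, wt p x * G x ^ 4 :=
    Finset.sum_le_sum fun x _ => by
      have : |f x| * G x ^ 4 ≤ G x ^ 4 := by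
        have h4 : 0 ≤ G x ^ 4 := by positivity
        nlinarith [hf x]
      exact mul_le_mul_of_nonneg_left this (hwt0 x)
  have hα0 : 0 ≤ α := Finset.sum_nonneg fun x _ => mul_nonneg (hwt0 x) (abs_nonneg _)
  have hM0 : 0 ≤ ∑ x : ι → Bool, wt p x * (|f x| * G x ^ 2) :=
    Finset.sum_nonneg fun x _ => mul_nonneg (hwt0 x) (mul_nonneg (abs_nonneg _) (sq_nonneg _))
  rw [hfG] at hCS1
  -- `S2⁴ ≤ α²·M² ≤ α³·E[G⁴] ≤ α³·S2²`
  have hchain : S2 ^ 4 ≤ α ^ 3 * S2 ^ 2 := by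
    calc S2 ^ 4 = (S2 ^ 2) ^ 2 := by ring
      _ ≤ (α * ∑ x : ι → Bool, wt p x * (|f x| * G x ^ 2)) ^ 2 :=
          pow_le_pow_left₀ (sq_nonneg _) hCS1 2
      _ = α ^ 2 * (∑ x : ι → Bool, wt p x * (|f x| * G x ^ 2)) ^ 2 := by ring
      _ ≤ α ^ 2 * (α * ∑ x : ι → Bool, wt p x * (|f x| * G x ^ 4)) :=
          mul_le_mul_of_nonneg_left hCS2 (sq_nonneg _)
      _ ≤ α ^ 2 * (α * S2 ^ 2) :=
          mul_le_mul_of_nonneg_left (mul_le_mul_of_nonneg_left (hfG4.trans hBon) hα0) (sq_nonneg _)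
      _ = α ^ 3 * S2 ^ 2 := by ring
  by_cases hS : S2 ^ 2 = 0
  · rw [hS]; positivity
  · have hSpos : 0 < S2 ^ 2 := lt_of_le_of_ne (sq_nonneg _) (Ne.symm hS)
    have : S2 ^ 2 * S2 ^ 2 ≤ α ^ 3 * S2 ^ 2 := by nlinarith
    exact le_of_mul_le_mul_right this hSpos

/-! ## §3 The level-`k` inequality -/

include h0 h1 hH1 hH2 in
/-- **THE LEVEL-`k` INEQUALITY**: under the hypotheses of `sq_noise_weight_le_cube`,
`((1−ε)^{2k}·Σ_{|S| ≤ k} f̂(S)²)² ≤ (E_p|f|)³` — since `(1−ε)^{2k} ≤ (1−ε)^{2|S|}` for `|S| ≤ k`.  For the indicator of an event of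
probability `α` the spectral mass below level `k` is at most `ρ^{−2k}α^{3/2}`, negligible against the total mass `α` as long as
`k ≤ c·log(1/α)`: small sets are high-frequency.
[cite: ODonnell2014, §9.5 Thm 9.22 / 9.24 (level-k inequalities) and §10.1] [cite: GarbanSteif2014, Ch. V §5.3] -/
theorem sq_low_weight_le_cube {ε : ℝ} (hρ2 : (1 - ε) ^ 2 ≤ 1 / 4)
    (hρ4 : ∀ i, 0 < p i → p i < 1 → 3 * (1 - ε) ^ 4 ≤ p i * (1 - p i))
    (f : (ι → Bool) → ℝ) (hf : ∀ x, |f x| ≤ 1) (k : ℕ) :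
    (((1 - ε) ^ 2) ^ k * ∑ S ∈ (Finset.univ : Finset ι).powerset.filter (fun S => S.card ≤ k),
        (∑ x : ι → Bool, wt p x * (f x * ∏ i ∈ S, r i (x i))) ^ 2) ^ 2
      ≤ (∑ x : ι → Bool, wt p x * |f x|) ^ 3 := by
  have hρ0 : 0 ≤ (1 - ε) ^ 2 := sq_nonneg _
  have hρ1 : (1 - ε) ^ 2 ≤ 1 := hρ2.trans (by norm_num)
  have hlow : ((1 - ε) ^ 2) ^ k * ∑ S ∈ (Finset.univ : Finset ι).powerset.filter (fun S => S.card ≤ k),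
        (∑ x : ι → Bool, wt p x * (f x * ∏ i ∈ S, r i (x i))) ^ 2
      ≤ ∑ S ∈ (Finset.univ : Finset ι).powerset,
        ((1 - ε) ^ 2) ^ S.card * (∑ x : ι → Bool, wt p x * (f x * ∏ i ∈ S, r i (x i))) ^ 2 := by
    rw [Finset.mul_sum]
    calc ∑ S ∈ (Finset.univ : Finset ι).powerset.filter (fun S => S.card ≤ k),
          ((1 - ε) ^ 2) ^ k * (∑ x : ι → Bool, wt p x * (f x * ∏ i ∈ S, r i (x i))) ^ 2
        ≤ ∑ S ∈ (Finset.univ : Finset ι).powerset.filter (fun S => S.card ≤ k),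
          ((1 - ε) ^ 2) ^ S.card * (∑ x : ι → Bool, wt p x * (f x * ∏ i ∈ S, r i (x i))) ^ 2 :=
          Finset.sum_le_sum fun S hS => mul_le_mul_of_nonneg_right
            (pow_le_pow_of_le_one hρ0 hρ1 (Finset.mem_filter.1 hS).2) (sq_nonneg _)
      _ ≤ ∑ S ∈ (Finset.univ : Finset ι).powerset,
          ((1 - ε) ^ 2) ^ S.card * (∑ x : ι → Bool, wt p x * (f x * ∏ i ∈ S, r i (x i))) ^ 2 :=
          Finset.sum_le_sum_of_subset_of_nonneg (Finset.filter_subset _ _)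
            fun S _ _ => mul_nonneg (pow_nonneg hρ0 _) (sq_nonneg _)
  have hl0 : 0 ≤ ((1 - ε) ^ 2) ^ k * ∑ S ∈ (Finset.univ : Finset ι).powerset.filter (fun S => S.card ≤ k),
        (∑ x : ι → Bool, wt p x * (f x * ∏ i ∈ S, r i (x i))) ^ 2 :=
    mul_nonneg (pow_nonneg hρ0 _) (Finset.sum_nonneg fun S _ => sq_nonneg _)
  exact (pow_le_pow_left₀ hl0 hlow 2).trans (sq_noise_weight_le_cube h0 h1 hH1 hH2 hρ2 hρ4 f hf)

include h0 h1 hH1 hH2 in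
/-- **THE LOW-LEVEL WEIGHT OF A SMALL FUNCTION**: under `0 < (1−ε)² ≤ 1/4`, `3(1−ε)⁴ ≤ p_i(1−p_i)` (nondegenerate `i`) and `|f| ≤ 1`,
`Σ_{|S| ≤ k} f̂(S)² ≤ (1−ε)^{−2k}·α·√α`, `α = E_p|f|` (square root of the level-`k` inequality).
[cite: ODonnell2014, §9.5 Thm 9.22 / 9.24 and §10.1] -/
theorem low_weight_le_inv_mul {ε : ℝ} (hρ0 : 0 < (1 - ε) ^ 2) (hρ2 : (1 - ε) ^ 2 ≤ 1 / 4)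
    (hρ4 : ∀ i, 0 < p i → p i < 1 → 3 * (1 - ε) ^ 4 ≤ p i * (1 - p i))
    (f : (ι → Bool) → ℝ) (hf : ∀ x, |f x| ≤ 1) (k : ℕ) :
    ∑ S ∈ (Finset.univ : Finset ι).powerset.filter (fun S => S.card ≤ k),
        (∑ x : ι → Bool, wt p x * (f x * ∏ i ∈ S, r i (x i))) ^ 2
      ≤ (((1 - ε) ^ 2) ^ k)⁻¹ * ((∑ x : ι → Bool, wt p x * |f x|) * Real.sqrt (∑ x : ι → Bool, wt p x * |f x|)) := by
  set α : ℝ := ∑ x : ι → Bool, wt p x * |f x| with hα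
  set W : ℝ := ∑ S ∈ (Finset.univ : Finset ι).powerset.filter (fun S => S.card ≤ k),
          (∑ x : ι → Bool, wt p x * (f x * ∏ i ∈ S, r i (x i))) ^ 2 with hW
  have hwt0 : ∀ x : ι → Bool, 0 ≤ wt p x := fun x => wt_nonneg h0 h1 x
  have hα0 : 0 ≤ α := Finset.sum_nonneg fun x _ => mul_nonneg (hwt0 x) (abs_nonneg _)
  have hW0 : 0 ≤ W := Finset.sum_nonneg fun S _ => sq_nonneg _
  have hlev := sq_low_weight_le_cube h0 h1 hH1 hH2 hρ2 hρ4 f hf k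
  rw [← hW, ← hα] at hlev
  have hρk : 0 < ((1 - ε) ^ 2) ^ k := pow_pos hρ0 k
  have hsq : ((1 - ε) ^ 2) ^ k * W ≤ α * Real.sqrt α := by
    have h3 : α * Real.sqrt α = Real.sqrt (α ^ 3) := by
      rw [show α ^ 3 = α * α * α by ring, Real.sqrt_mul (mul_nonneg hα0 hα0), Real.sqrt_mul_self hα0]
    rw [h3]
    exact Real.le_sqrt_of_sq_le hlev
  rw [le_inv_mul_iff₀ hρk]
  exact hsq

/-! ## §4 The small-set expansion of the noisy cube -/

include hH1 hH2 in
/-- **NOISE CORRELATION = LOW LEVELS + TAIL**: for `0 ≤ ε' ≤ 1` and every `k`,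
`E_p[f(ω)f(ω^{ε'})] ≤ Σ_{|S| ≤ k} f̂(S)² + (1−ε')^{k+1}·E_p[f²]` (spectral formula; `(1−ε')^{|S|} ≤ 1` below level `k` and
`≤ (1−ε')^{k+1}` above it; Parseval). [cite: GarbanSteif2014, Ch. IV (1.3)–(1.4) and Prop IV.1] [cite: ODonnell2014, §2.4 Prop 2.47 / §9.5] -/
theorem noise_correlation_le_low_add_tail (f : (ι → Bool) → ℝ) {ε' : ℝ} (hε'0 : 0 ≤ ε') (hε'1 : ε' ≤ 1) (k : ℕ) :
    ∑ x : ι → Bool, ∑ y : ι → Bool, ∑ m : ι → Bool, wt p x * wt p y * wt (fun _ => ε') m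
        * (f x * f (fun i => if m i = true then y i else x i))
      ≤ (∑ S ∈ (Finset.univ : Finset ι).powerset.filter (fun S => S.card ≤ k),
          (∑ x : ι → Bool, wt p x * (f x * ∏ i ∈ S, r i (x i))) ^ 2)
        + (1 - ε') ^ (k + 1) * ∑ x : ι → Bool, wt p x * (f x * f x) := by
  rw [noise_correlation_eq_sum_coeff_sq hH1 hH2 f ε', sum_wt_mul_sq_eq_sum_coeff_sq hH2 f]
  have hq0 : 0 ≤ 1 - ε' := by linarith
  have hq1 : 1 - ε' ≤ 1 := by linarith
  rw [← Finset.sum_filter_add_sum_filter_not (Finset.univ : Finset ι).powerset (fun S => S.card ≤ k), Finset.mul_sum]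
  refine add_le_add (Finset.sum_le_sum fun S _ => ?_) ?_
  · calc (1 - ε') ^ S.card * (∑ x : ι → Bool, wt p x * (f x * ∏ i ∈ S, r i (x i))) ^ 2
        ≤ 1 * (∑ x : ι → Bool, wt p x * (f x * ∏ i ∈ S, r i (x i))) ^ 2 :=
          mul_le_mul_of_nonneg_right (pow_le_one₀ hq0 hq1) (sq_nonneg _)
      _ = _ := one_mul _
  · calc ∑ S ∈ (Finset.univ : Finset ι).powerset.filter (fun S => ¬ S.card ≤ k),
          (1 - ε') ^ S.card * (∑ x : ι → Bool, wt p x * (f x * ∏ i ∈ S, r i (x i))) ^ 2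
        ≤ ∑ S ∈ (Finset.univ : Finset ι).powerset.filter (fun S => ¬ S.card ≤ k),
          (1 - ε') ^ (k + 1) * (∑ x : ι → Bool, wt p x * (f x * ∏ i ∈ S, r i (x i))) ^ 2 :=
          Finset.sum_le_sum fun S hS => mul_le_mul_of_nonneg_right
            (pow_le_pow_of_le_one hq0 hq1 (by have := (Finset.mem_filter.1 hS).2; omega)) (sq_nonneg _)
      _ ≤ ∑ S ∈ (Finset.univ : Finset ι).powerset,
          (1 - ε') ^ (k + 1) * (∑ x : ι → Bool, wt p x * (f x * ∏ i ∈ S, r i (x i))) ^ 2 :=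
          Finset.sum_le_sum_of_subset_of_nonneg (Finset.filter_subset _ _)
            fun S _ _ => mul_nonneg (pow_nonneg hq0 _) (sq_nonneg _)

include h0 h1 hH1 hH2 in
/-- **THE SMALL-SET EXPANSION OF THE NOISY CUBE**: if `|f| ≤ 1`, `0 < (1−ε)² ≤ 1/4`, `3(1−ε)⁴ ≤ p_i(1−p_i)` at the nondegenerate
coordinates, then for every second noise level `0 ≤ ε' ≤ 1` and every `k`, with `α = E_p|f|`,

  **`E_p[f(ω)·f(ω^{ε'})] ≤ (1−ε)^{−2k}·α·√α + (1−ε')^{k+1}·α`**.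

For `f = 𝟙_A`: `P(ω ∈ A, ω^{ε'} ∈ A) ≤ P(A)·((1−ε)^{−2k}√P(A) + (1−ε')^{k+1})` — a RARE event is shared by two `ε'`-correlated
configurations with conditional probability `→ 0` as `P(A) → 0`, polynomially in `P(A)` (`k ≍ log(1/P(A))`), for every fixed `ε' > 0`.
[cite: ODonnell2014, §9.5 (small-set expansion of the noisy hypercube from the level-k inequality) and §10.1]
[cite: GarbanSteif2014, Ch. V §5.3] [cite: BenjaminiKalaiSchramm1999, §1.4–§3 (noise sensitivity via Bonami–Beckner)] -/
theorem noise_correlation_le_of_abs_le_one {ε : ℝ} (hρ0 : 0 < (1 - ε) ^ 2) (hρ2 : (1 - ε) ^ 2 ≤ 1 / 4)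
    (hρ4 : ∀ i, 0 < p i → p i < 1 → 3 * (1 - ε) ^ 4 ≤ p i * (1 - p i))
    (f : (ι → Bool) → ℝ) (hf : ∀ x, |f x| ≤ 1) {ε' : ℝ} (hε'0 : 0 ≤ ε') (hε'1 : ε' ≤ 1) (k : ℕ) :
    ∑ x : ι → Bool, ∑ y : ι → Bool, ∑ m : ι → Bool, wt p x * wt p y * wt (fun _ => ε') m
        * (f x * f (fun i => if m i = true then y i else x i))
      ≤ (((1 - ε) ^ 2) ^ k)⁻¹ * ((∑ x : ι → Bool, wt p x * |f x|) * Real.sqrt (∑ x : ι → Bool, wt p x * |f x|))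
        + (1 - ε') ^ (k + 1) * ∑ x : ι → Bool, wt p x * |f x| := by
  set α : ℝ := ∑ x : ι → Bool, wt p x * |f x| with hα
  have hwt0 : ∀ x : ι → Bool, 0 ≤ wt p x := fun x => wt_nonneg h0 h1 x
  have h1st := noise_correlation_le_low_add_tail hH1 hH2 f hε'0 hε'1 k
  have hW := low_weight_le_inv_mul h0 h1 hH1 hH2 hρ0 hρ2 hρ4 f hf k
  rw [← hα] at hW
  -- `E f² ≤ E|f|`
  have hf2 : ∑ x : ι → Bool, wt p x * (f x * f x) ≤ α :=
    Finset.sum_le_sum fun x _ => mul_le_mul_of_nonneg_left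
      (by rw [← abs_mul_abs_self (f x)]; nlinarith [abs_nonneg (f x), hf x]) (hwt0 x)
  have htail : (1 - ε') ^ (k + 1) * ∑ x : ι → Bool, wt p x * (f x * f x) ≤ (1 - ε') ^ (k + 1) * α :=
    mul_le_mul_of_nonneg_left hf2 (pow_nonneg (by linarith) _)
  linarith

end Levels

/-! ## §5 Character-free form (the p-biased characters inside) -/

/-- **THE SMALL-SET EXPANSION OF THE NOISY CUBE, character-free** (every `p ∈ [0,1]^ι`; `0 < (1−ε)² ≤ 1/4`, `3(1−ε)⁴ ≤ p_i(1−p_i)` at the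
nondegenerate coordinates — e.g. `(1−ε)² = min_i p_i(1−p_i)`; `|f| ≤ 1`; `0 ≤ ε' ≤ 1`; every `k`; `α = E_p|f|`):
**`E_p[f(ω)f(ω^{ε'})] ≤ (1−ε)^{−2k}·α√α + (1−ε')^{k+1}·α`**.  For an event `A`: `P(A ∩ A^{ε'}) ≤ P(A)((1−ε)^{−2k}√P(A) + (1−ε')^{k+1})`.
[cite: ODonnell2014, §9.5 and §10.1 (small-set expansion on the p-biased cube)] [cite: GarbanSteif2014, Ch. V §5.3] -/
theorem noise_correlation_le_of_abs_le_one' (p : ι → ℝ) (h0 : ∀ i, 0 ≤ p i) (h1 : ∀ i, p i ≤ 1)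
    {ε : ℝ} (hρ0 : 0 < (1 - ε) ^ 2) (hρ2 : (1 - ε) ^ 2 ≤ 1 / 4)
    (hρ4 : ∀ i, 0 < p i → p i < 1 → 3 * (1 - ε) ^ 4 ≤ p i * (1 - p i))
    (f : (ι → Bool) → ℝ) (hf : ∀ x, |f x| ≤ 1) {ε' : ℝ} (hε'0 : 0 ≤ ε') (hε'1 : ε' ≤ 1) (k : ℕ) :
    ∑ x : ι → Bool, ∑ y : ι → Bool, ∑ m : ι → Bool, wt p x * wt p y * wt (fun _ => ε') m
        * (f x * f (fun i => if m i = true then y i else x i))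
      ≤ (((1 - ε) ^ 2) ^ k)⁻¹ * ((∑ x : ι → Bool, wt p x * |f x|) * Real.sqrt (∑ x : ι → Bool, wt p x * |f x|))
        + (1 - ε') ^ (k + 1) * ∑ x : ι → Bool, wt p x * |f x| :=
  noise_correlation_le_of_abs_le_one h0 h1 (pbiased_H1 p) (pbiased_H2 p h0 h1) hρ0 hρ2 hρ4 f hf hε'0 hε'1 k

/-- **THE LEVEL-`k` INEQUALITY, character-free** (p-biased coefficients `f̂(S) = E_p[f·Π_{i∈S}(𝟙[x_i]−p_i)/√(p_i(1−p_i))]`):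
`((1−ε)^{2k}·Σ_{|S| ≤ k} f̂(S)²)² ≤ (E_p|f|)³`. [cite: ODonnell2014, §9.5 Thm 9.22 and §10.1] -/
theorem sq_low_weight_le_cube' (p : ι → ℝ) (h0 : ∀ i, 0 ≤ p i) (h1 : ∀ i, p i ≤ 1)
    {ε : ℝ} (hρ2 : (1 - ε) ^ 2 ≤ 1 / 4) (hρ4 : ∀ i, 0 < p i → p i < 1 → 3 * (1 - ε) ^ 4 ≤ p i * (1 - p i))
    (f : (ι → Bool) → ℝ) (hf : ∀ x, |f x| ≤ 1) (k : ℕ) :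
    (((1 - ε) ^ 2) ^ k * ∑ S ∈ (Finset.univ : Finset ι).powerset.filter (fun S => S.card ≤ k),
        (∑ x : ι → Bool, wt p x * (f x * ∏ i ∈ S,
          (((if x i then (1 : ℝ) else 0) - p i) / Real.sqrt (p i * (1 - p i))))) ^ 2) ^ 2
      ≤ (∑ x : ι → Bool, wt p x * |f x|) ^ 3 :=
  sq_low_weight_le_cube h0 h1 (pbiased_H1 p) (pbiased_H2 p h0 h1) hρ2 hρ4 f hf k

end Summit.CriticalPhenomena.PercolationContinuityZ3.Theorems.Crossing.Spectral

end
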